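import Literature.Barriers.ValiantsHypothesis.CT23KroneckerEvaluationPoints
import Literature.Barriers.ValiantsHypothesis.CT23ProjCircuitSubstitution
import HarnessLib

/-!
# Circuits with projection gates under a change of coefficients; descent of constant-free
# circuits to `ℤ`; a NATURAL-NUMBER rank extractor (Chatterjee–Tengse arXiv:2309.07612v2,
# Def. 2.20 "constant-free … circuit with projection gates", Lemma 3.2/3.5 "some positive integer
# `α < D^{2n}` … `α` can be computed by a constant-free circuit of size `O(n log(nd))`";
# val-lit t18 g8, X-CT23 brick E-h)

Plumbing for the assembly of `CT23_thm_3_1` / `CT23_lemma_4_7` (bricks E-f): theorems and four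
plumbing `def`s (`ProjCircuit.Gate.map`, `ProjCircuit.map`, the `liftInt`s), NO named facts.
Honest framing: bookkeeping; `VP ≠ VNP` is NOT proved and nothing here bears on it.

1. **Base change** `ProjCircuit.map φ` along a ring homomorphism (Bürgisser 2000 §4.1 for ordinary
   circuits; the tree's `ArithCircuit.map`): `eval_map` (`(P.map φ).eval = map φ P.eval`, because
   `proj_{x=b}` commutes with `map φ`, `map_projVar`), size / fan-in / sign constants / projected
   variables preserved. This moves the INTEGER encoders of Lemma 4.7 into a field of
   characteristic `0`, where the engine's linear algebra (Lemma 3.2) lives.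
2. **Descent**: a CONSTANT-FREE circuit with projection gates over any commutative ring is the
   base change of a constant-free circuit over `ℤ` (`liftInt`, `map_liftInt`,
   `exists_int_of_hasSignConstants`) — Def. 2.20's "constant-free algebraic circuit" has integer
   semantics; together with `exists_eq_rename_of_map_eq_rename` (an integer polynomial whose image
   is free of the workspace variables is itself free of them) this brings the engine's output back
   to `ℤ`, as `CT23_lemma_4_7` (integer equations) requires.
3. **A natural-number rank extractor** (`exists_nat_kronecker_det_eval_ne_zero`): the good field
   element `α` of Claim 3.3 / `exists_kronecker_det_eval_ne_zero` can be taken to be a natural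
   number `α ≤ Δ^m K²` (a nonzero polynomial of degree `≤ Δ^m K²` does not vanish on
   `{0, …, Δ^m K²} ⊆ F`, characteristic `0`) — the source's "positive integer `α < D^{2n}`", needed
   because a CONSTANT-FREE circuit may only use `α` through a numeral; and the numeral is cheap:
   `constantFreeComplexity_C_natCast_le_log` (`τ(a) ≤ 3 (log₂ a + 1)`, Horner on the bits; the
   source's "`α` can be computed by a constant-free circuit of size `O(log α)`").

## References

* [ChatterjeeTengse2023] P. Chatterjee, A. Tengse, *Lower Bounds from Succinct Hitting Sets*,
  arXiv:2309.07612v2, Def. 2.20, Lemma 3.2 / Claim 3.3, Lemma 3.5 (v1: Def. 28, Lemma 39 /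
  Claim 40, Lemma 42; held text `paper:arxiv-2309.07612` p0010.txt:L76, p0014.txt:L78–L92,
  p0015.txt:L70–L76).
* [Burgisser2000] P. Bürgisser, *Completeness and Reduction in Algebraic Complexity Theory* (2000),
  §4.1 (extension of scalars), §1.4 (constant-free model).
* [AgrawalEtAl2011] M. Agrawal, C. Saha, R. Saptharishi, N. Saxena, arXiv:1111.0582, Lemma 7.1 /
  Cor. 7.2 (the rank extractor `(α^{ij})`).
-/

noncomputable section

open MvPolynomial

namespace Literature.Barriers.ValiantsHypothesis

open Literature.Computability.AlgebraicComplexity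

universe u u' v w

/-! ### §1. Base change of circuits with projection gates -/

section MapProjVar

variable {k : Type u} {k' : Type u'} [CommSemiring k] [CommSemiring k'] {σ : Type v} [DecidableEq σ]

/-- `map φ` commutes with projecting a variable: `(proj_{x=b} f)^φ = proj_{x=φ b} f^φ`.
[cite: ChatterjeeTengse2023, Def. 2.19 (v1: Def. 27); Burgisser2000, §4.1] -/
theorem map_projVar (φ : k →+* k') (i : σ) (b : k) (f : MvPolynomial σ k) :
    MvPolynomial.map φ (projVar i b f) = projVar i (φ b) (MvPolynomial.map φ f) := by
  have hfun : (fun j => MvPolynomial.map φ (if j = i then C b else (X j : MvPolynomial σ k))) =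
      (fun j => if j = i then C (φ b) else (X j : MvPolynomial σ k')) := by
    funext j
    split_ifs <;> simp
  unfold projVar
  rw [aeval_eq_bind₁, aeval_eq_bind₁, map_bind₁, hfun]

end MapProjVar

namespace ProjCircuit

variable {k : Type u} {k' : Type u'} {σ : Type v}

section MapDefs

/-- Base change of a gate along `φ : k → k'` (constants and sum coefficients through `φ`; the
Boolean label of a projection gate is kept). [cite: Burgisser2000, §4.1; ChatterjeeTengse2023, Def. 2.20 (v1: Def. 28)] -/
def Gate.map (φ : k → k') : Gate k σ → Gate k' σ
  | .arith g => .arith (g.map φ)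
  | .proj i b u => .proj i b (u.map φ)

/-- **Base change of a circuit with projection gates** along `φ : k → k'`.
[cite: Burgisser2000, §4.1; ChatterjeeTengse2023, Def. 2.20 (v1: Def. 28)] -/
def map (φ : k → k') (P : ProjCircuit k σ) : ProjCircuit k' σ where
  gates := P.gates.map (Gate.map φ)
  output := P.output.map φ

/-- Base change keeps the size. [cite: Burgisser2000, §4.1] -/
@[simp] theorem size_map (φ : k → k') (P : ProjCircuit k σ) : (P.map φ).size = P.size := by
  simp [map, size]

/-- Base change keeps the fan-in of a gate. [cite: Burgisser2000, §4.1] -/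
theorem Gate.fanIn_map [CommSemiring k] [CommSemiring k'] (φ : k → k') (g : Gate k σ) :
    (Gate.map φ g).fanIn = g.fanIn := by
  cases g with
  | arith g => cases g <;> simp [Gate.map, Gate.fanIn, ArithCircuit.Gate.map, ArithCircuit.Gate.fanIn,
      ArithCircuit.Gate.args]
  | proj i b u => simp [Gate.map, Gate.fanIn]

/-- Base change keeps fan-in two. [cite: Burgisser2000, §4.1] -/
theorem isFanInTwo_map [CommSemiring k] [CommSemiring k'] (φ : k → k') {P : ProjCircuit k σ}
    (hP : P.IsFanInTwo) : (P.map φ).IsFanInTwo := by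
  intro g hg
  simp only [map, List.mem_map] at hg
  obtain ⟨g', hg', rfl⟩ := hg
  rw [Gate.fanIn_map]
  exact hP g' hg'

/-- Base change keeps the set of projected variables. [cite: ChatterjeeTengse2023, Def. 2.19 (v1: Def. 27)] -/
theorem projVars_map (φ : k → k') (P : ProjCircuit k σ) : (P.map φ).projVars = P.projVars := by
  ext i
  constructor
  · rintro ⟨b, u, hg⟩
    simp only [map, List.mem_map] at hg
    obtain ⟨g', hg', hgg⟩ := hg
    cases g' with
    | arith g => simp [Gate.map] at hgg
    | proj i' b' u' =>
      simp only [Gate.map, Gate.proj.injEq] at hgg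
      obtain ⟨rfl, rfl, -⟩ := hgg
      exact ⟨b', u', hg'⟩
  · rintro ⟨b, u, hg⟩
    exact ⟨b, u.map φ, List.mem_map.2 ⟨_, hg, rfl⟩⟩

end MapDefs

section MapSign

variable [CommSemiring k] [CommSemiring k']

/-- A ring homomorphism keeps sign constants. [cite: Burgisser2000, §1.4, §4.1] -/
theorem isSignConstant_map (φ : k →+* k') {c : k} (hc : ArithCircuit.IsSignConstant c) :
    ArithCircuit.IsSignConstant (φ c) := by
  rcases hc with rfl | rfl | h
  · exact Or.inl (map_zero φ)
  · exact Or.inr (Or.inl (map_one φ))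
  · refine Or.inr (Or.inr ?_)
    have h' := congrArg φ h
    simpa using h'

/-- Base change keeps sign constants of operands. [cite: Burgisser2000, §1.4, §4.1] -/
theorem _root_.Literature.Computability.AlgebraicComplexity.ArithCircuit.Operand.hasSignConstants_map
    (φ : k →+* k') {u : ArithCircuit.Operand k σ} (hu : u.HasSignConstants) :
    (u.map φ).HasSignConstants := by
  cases u with
  | var i => trivial
  | const c => exact isSignConstant_map φ hu
  | gate j => trivial

/-- Base change keeps sign constants of arithmetic gates. [cite: Burgisser2000, §1.4, §4.1] -/
theorem _root_.Literature.Computability.AlgebraicComplexity.ArithCircuit.Gate.hasSignConstants_map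
    (φ : k →+* k') {g : ArithCircuit.Gate k σ} (hg : g.HasSignConstants) :
    (g.map φ).HasSignConstants := by
  cases g with
  | sum args =>
    intro a ha
    simp only [List.mem_map] at ha
    obtain ⟨a', ha', rfl⟩ := ha
    exact ⟨isSignConstant_map φ (hg a' ha').1,
      ArithCircuit.Operand.hasSignConstants_map φ (hg a' ha').2⟩
  | prod args =>
    intro u hu
    simp only [List.mem_map] at hu
    obtain ⟨u', hu', rfl⟩ := hu
    exact ArithCircuit.Operand.hasSignConstants_map φ (hg u' hu')

/-- **Base change keeps constant-freeness.** [cite: ChatterjeeTengse2023, Def. 2.20 (v1: Def. 28); Burgisser2000, §4.1] -/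
theorem hasSignConstants_map (φ : k →+* k') {P : ProjCircuit k σ} (hP : P.HasSignConstants) :
    (P.map φ).HasSignConstants := by
  refine ⟨fun g hg => ?_, ArithCircuit.Operand.hasSignConstants_map φ hP.2⟩
  simp only [map, List.mem_map] at hg
  obtain ⟨g', hg', rfl⟩ := hg
  cases g' with
  | arith g => exact ArithCircuit.Gate.hasSignConstants_map φ (hP.1 _ hg')
  | proj i b u => exact ArithCircuit.Operand.hasSignConstants_map φ (hP.1 _ hg')

end MapSign

section MapSemantics

variable [CommSemiring k] [CommSemiring k'] [DecidableEq σ]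

omit [DecidableEq σ] in
/-- A mapped operand, read against the mapped value list, evaluates to the mapped value (twin of
the tree's `ArithCircuit.Operand.eval_map`). [cite: Burgisser2000, §4.1] -/
private theorem operand_eval_map (φ : k →+* k') (vals : List (MvPolynomial σ k))
    (u : ArithCircuit.Operand k σ) :
    (u.map φ).eval (vals.map (MvPolynomial.map φ)) = MvPolynomial.map φ (u.eval vals) := by
  cases u with
  | var i => simp [ArithCircuit.Operand.map, ArithCircuit.Operand.eval]
  | const c => simp [ArithCircuit.Operand.map, ArithCircuit.Operand.eval]
  | gate j =>
    simp only [ArithCircuit.Operand.map, ArithCircuit.Operand.eval, List.getD_eq_getElem?_getD,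
      List.getElem?_map]
    cases vals[j]? <;> simp

omit [DecidableEq σ] in
/-- A mapped arithmetic gate, read against the mapped value list, evaluates to the mapped value
(twin of the tree's `ArithCircuit.Gate.eval_map`). [cite: Burgisser2000, §4.1] -/
private theorem arithGate_eval_map (φ : k →+* k') (vals : List (MvPolynomial σ k))
    (g : ArithCircuit.Gate k σ) :
    (g.map φ).eval (vals.map (MvPolynomial.map φ)) = MvPolynomial.map φ (g.eval vals) := by
  cases g with
  | sum args =>
    simp only [ArithCircuit.Gate.map, ArithCircuit.Gate.eval, List.map_map, map_list_sum]
    congr 1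
    simp [Function.comp_def, operand_eval_map, MvPolynomial.smul_eq_C_mul, map_C]
  | prod args =>
    simp only [ArithCircuit.Gate.map, ArithCircuit.Gate.eval, List.map_map, map_list_prod]
    congr 1
    simp [Function.comp_def, operand_eval_map]

/-- A mapped gate (arithmetic or projection) evaluates to the mapped value.
[cite: Burgisser2000, §4.1; ChatterjeeTengse2023, Def. 2.19 (v1: Def. 27)] -/
theorem Gate.eval_map (φ : k →+* k') (vals : List (MvPolynomial σ k)) (g : Gate k σ) :
    (Gate.map φ g).eval (vals.map (MvPolynomial.map φ)) = MvPolynomial.map φ (g.eval vals) := by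
  cases g with
  | arith g => exact arithGate_eval_map φ vals g
  | proj i b u =>
    simp only [Gate.map, Gate.eval]
    rw [operand_eval_map, map_projVar]
    congr 1
    split_ifs <;> simp

/-- The value list of the base-changed circuit is the mapped value list (projection-gate twin of
the tree's `ArithCircuit.gateValues_map`). [cite: Burgisser2000, §4.1; ChatterjeeTengse2023, Def. 2.20 (v1: Def. 28)] -/
theorem gateValues_gates_map (φ : k →+* k') (P : ProjCircuit k σ) :
    gateValues (P.map φ).gates = (gateValues P.gates).map (MvPolynomial.map φ) := by
  change gateValues (P.gates.map (Gate.map φ)) = _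
  induction P.gates using List.reverseRecOn with
  | nil => rfl
  | append_singleton gs g ih =>
    rw [List.map_append, List.map_singleton, gateValues_append_singleton,
      gateValues_append_singleton, ih, Gate.eval_map, List.map_append, List.map_singleton]

/-- **Base change maps the computed polynomial**: `(P.map φ).eval = map φ P.eval`.
[cite: Burgisser2000, §4.1; ChatterjeeTengse2023, Def. 2.20 (v1: Def. 28)] -/
theorem eval_map (φ : k →+* k') (P : ProjCircuit k σ) :
    (P.map φ).eval = MvPolynomial.map φ P.eval := by
  change (P.output.map φ).eval (gateValues (P.map φ).gates) = _
  rw [gateValues_gates_map, operand_eval_map]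
  rfl

/-- If `P` computes `f` then `P.map φ` computes `map φ f`. [cite: Burgisser2000, §4.1] -/
theorem computes_map (φ : k →+* k') {P : ProjCircuit k σ} {f : MvPolynomial σ k}
    (h : P.Computes f) : (P.map φ).Computes (MvPolynomial.map φ f) := by
  unfold Computes at h ⊢
  rw [eval_map, h]

end MapSemantics

/-! ### §2. Descent: constant-free circuits are defined over `ℤ` -/

section Descent

variable [CommRing k]

open Classical in
/-- The integer behind a sign constant (`0 ↦ 0`, `1 ↦ 1`, otherwise `−1`).
[cite: Burgisser2000, §1.4] -/
def liftConst (c : k) : ℤ := if c = 0 then 0 else if c = 1 then 1 else -1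

/-- `liftConst` is a sign constant. [cite: Burgisser2000, §1.4] -/
theorem isSignConstant_liftConst (c : k) : ArithCircuit.IsSignConstant (liftConst c) := by
  unfold liftConst
  split_ifs
  · exact Or.inl rfl
  · exact Or.inr (Or.inl rfl)
  · exact Or.inr (Or.inr (by norm_num))

/-- A sign constant is the image of its integer. [cite: Burgisser2000, §1.4, §4.1] -/
theorem cast_liftConst {c : k} (hc : ArithCircuit.IsSignConstant c) :
    (Int.castRingHom k) (liftConst c) = c := by
  unfold liftConst
  split_ifs with h0 h1
  · simp [h0]
  · simp [h1]
  · rcases hc with h | h | h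
    · exact absurd h h0
    · exact absurd h h1
    · have : c = -1 := eq_neg_of_add_eq_zero_left h
      simp [this]

/-- Integer lift of an operand. [cite: Burgisser2000, §1.4] -/
def _root_.Literature.Computability.AlgebraicComplexity.ArithCircuit.Operand.liftInt :
    ArithCircuit.Operand k σ → ArithCircuit.Operand ℤ σ
  | .var i => .var i
  | .const c => .const (liftConst c)
  | .gate j => .gate j

/-- Integer lift of an arithmetic gate. [cite: Burgisser2000, §1.4] -/
def _root_.Literature.Computability.AlgebraicComplexity.ArithCircuit.Gate.liftInt :
    ArithCircuit.Gate k σ → ArithCircuit.Gate ℤ σ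
  | .sum args => .sum (args.map fun a => (liftConst a.1, a.2.liftInt))
  | .prod args => .prod (args.map ArithCircuit.Operand.liftInt)

/-- Integer lift of a gate with projections. [cite: Burgisser2000, §1.4; ChatterjeeTengse2023, Def. 2.20 (v1: Def. 28)] -/
def Gate.liftInt : Gate k σ → Gate ℤ σ
  | .arith g => .arith g.liftInt
  | .proj i b u => .proj i b u.liftInt

/-- **Integer lift of a circuit with projection gates** (every constant replaced by the integer
behind it). [cite: Burgisser2000, §1.4; ChatterjeeTengse2023, Def. 2.20 (v1: Def. 28)] -/
def liftInt (P : ProjCircuit k σ) : ProjCircuit ℤ σ where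
  gates := P.gates.map Gate.liftInt
  output := P.output.liftInt

/-- The lift of a sign-constant operand maps back to it. [cite: Burgisser2000, §1.4, §4.1] -/
theorem operand_map_liftInt {u : ArithCircuit.Operand k σ} (hu : u.HasSignConstants) :
    u.liftInt.map (Int.castRingHom k) = u := by
  cases u with
  | var i => rfl
  | const c =>
    simp only [ArithCircuit.Operand.liftInt, ArithCircuit.Operand.map]
    rw [cast_liftConst hu]
  | gate j => rfl

/-- The lift of a sign-constant arithmetic gate maps back to it. [cite: Burgisser2000, §1.4, §4.1] -/
theorem arithGate_map_liftInt {g : ArithCircuit.Gate k σ} (hg : g.HasSignConstants) :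
    g.liftInt.map (Int.castRingHom k) = g := by
  cases g with
  | sum args =>
    simp only [ArithCircuit.Gate.liftInt, ArithCircuit.Gate.map, List.map_map]
    congr 1
    conv_rhs => rw [← List.map_id args]
    refine List.map_congr_left fun a ha => ?_
    obtain ⟨h1, h2⟩ := hg a ha
    simp only [Function.comp_apply, id]
    rw [cast_liftConst h1, operand_map_liftInt h2]
  | prod args =>
    simp only [ArithCircuit.Gate.liftInt, ArithCircuit.Gate.map, List.map_map]
    congr 1
    conv_rhs => rw [← List.map_id args]
    refine List.map_congr_left fun u hu => ?_
    simp only [Function.comp_apply, id]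
    exact operand_map_liftInt (hg u hu)

/-- **A constant-free circuit with projection gates is the base change of its integer lift.**
[cite: ChatterjeeTengse2023, Def. 2.20 (v1: Def. 28); Burgisser2000, §1.4, §4.1] -/
theorem map_liftInt {P : ProjCircuit k σ} (hP : P.HasSignConstants) :
    P.liftInt.map (Int.castRingHom k) = P := by
  obtain ⟨gates, output⟩ := P
  simp only [liftInt, map, List.map_map, ProjCircuit.mk.injEq]
  refine ⟨?_, operand_map_liftInt hP.2⟩
  conv_rhs => rw [← List.map_id gates]
  refine List.map_congr_left fun g hg => ?_
  simp only [Function.comp_apply, id]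
  cases g with
  | arith g =>
    simp only [Gate.liftInt, Gate.map]
    rw [arithGate_map_liftInt (hP.1 _ hg)]
  | proj i b u =>
    simp only [Gate.liftInt, Gate.map]
    rw [operand_map_liftInt (hP.1 _ hg)]

/-- The integer lift is constant-free (whatever `P` is). [cite: Burgisser2000, §1.4] -/
theorem hasSignConstants_liftInt (P : ProjCircuit k σ) : P.liftInt.HasSignConstants := by
  have hop : ∀ u : ArithCircuit.Operand k σ, u.liftInt.HasSignConstants := fun u => by
    cases u with
    | var i => trivial
    | const c => exact isSignConstant_liftConst c
    | gate j => trivial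
  refine ⟨fun g hg => ?_, hop _⟩
  simp only [liftInt, List.mem_map] at hg
  obtain ⟨g', -, rfl⟩ := hg
  cases g' with
  | arith g =>
    cases g with
    | sum args =>
      intro a ha
      simp only [List.mem_map] at ha
      obtain ⟨a', -, rfl⟩ := ha
      exact ⟨isSignConstant_liftConst _, hop _⟩
    | prod args =>
      intro u hu
      simp only [List.mem_map] at hu
      obtain ⟨u', -, rfl⟩ := hu
      exact hop _
  | proj i b u => exact hop u

/-- **Descent.** A constant-free circuit with projection gates over any ring is `map (ℤ → k)` of a
constant-free integer circuit of the same size, fan-in and projected variables.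
[cite: ChatterjeeTengse2023, Def. 2.20 (v1: Def. 28); Burgisser2000, §1.4, §4.1] -/
theorem exists_int_of_hasSignConstants {P : ProjCircuit k σ} (hP : P.HasSignConstants) :
    ∃ P₀ : ProjCircuit ℤ σ, P₀.map (Int.castRingHom k) = P ∧ P₀.HasSignConstants ∧
      P₀.size = P.size ∧ P₀.projVars = P.projVars := by
  refine ⟨P.liftInt, map_liftInt hP, hasSignConstants_liftInt P, ?_, ?_⟩
  · rw [← size_map (Int.castRingHom k) P.liftInt, map_liftInt hP]
  · rw [← projVars_map (Int.castRingHom k) P.liftInt, map_liftInt hP]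

end Descent

section DescentSemantics

variable [CommRing k] [DecidableEq σ]

/-- **Descent with semantics**: a constant-free fan-in-two circuit with projection gates over a
commutative ring computes `map (ℤ → k)` of the polynomial computed by a constant-free fan-in-two
INTEGER circuit of the same size and projected variables.
[cite: ChatterjeeTengse2023, Def. 2.20 (v1: Def. 28); Burgisser2000, §1.4, §4.1] -/
theorem exists_int_computes {P : ProjCircuit k σ} (hP : P.HasSignConstants) (h2 : P.IsFanInTwo) :
    ∃ P₀ : ProjCircuit ℤ σ, P₀.IsFanInTwo ∧ P₀.HasSignConstants ∧
      MvPolynomial.map (Int.castRingHom k) P₀.eval = P.eval ∧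
      P₀.size = P.size ∧ P₀.projVars = P.projVars := by
  obtain ⟨P₀, hmap, hsc, hsize, hpv⟩ := exists_int_of_hasSignConstants hP
  refine ⟨P₀, ?_, hsc, ?_, hsize, hpv⟩
  · intro g hg
    have hg' : Gate.map (Int.castRingHom k) g ∈ P.gates := by
      rw [← hmap]
      exact List.mem_map.2 ⟨g, hg, rfl⟩
    have := h2 _ hg'
    rwa [Gate.fanIn_map] at this
  · rw [← eval_map, hmap]

end DescentSemantics

end ProjCircuit

/-! ### §3. Integer polynomials whose image is free of the workspace variables -/

section PolyDescent

variable {R : Type u} {S : Type u'} [CommRing R] [CommRing S] {σ : Type v} {τ : Type w}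

/-- If `map φ f = rename inl g` with `φ` injective, then `f = rename inl f₀` with `map φ f₀ = g`
(the variables of `f` are those of its image). [cite: Burgisser2000, §4.1] -/
theorem exists_eq_rename_of_map_eq_rename {φ : R →+* S} (hφ : Function.Injective φ)
    (f : MvPolynomial (σ ⊕ τ) R) (g : MvPolynomial σ S)
    (h : MvPolynomial.map φ f = rename Sum.inl g) :
    ∃ f₀ : MvPolynomial σ R, f = rename Sum.inl f₀ ∧ MvPolynomial.map φ f₀ = g := by
  classical
  have hvars : ↑f.vars ⊆ Set.range (Sum.inl : σ → σ ⊕ τ) := by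
    intro v hv
    rw [← vars_map_of_injective f hφ, h] at hv
    have hv' := vars_rename _ _ hv
    simp only [Finset.mem_image] at hv'
    obtain ⟨i, -, rfl⟩ := hv'
    exact ⟨i, rfl⟩
  obtain ⟨f₀, hf₀⟩ := exists_rename_eq_of_vars_subset_range f Sum.inl Sum.inl_injective hvars
  refine ⟨f₀, hf₀.symm, rename_injective (Sum.inl : σ → σ ⊕ τ) Sum.inl_injective ?_⟩
  rw [← map_rename, hf₀, h]

end PolyDescent

/-! ### §4. A natural-number rank extractor and cheap numerals -/

section NatExtractor

open Polynomial in
/-- Degree count (twin of the tree's private `natDegree_det_mul_powMatrix_le`): every entry of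
`B · (u^{(x+1)(j+1)})` has degree `≤ n·k`, so the determinant has degree `≤ n·k²`.
[cite: AgrawalEtAl2011, Cor. 7.2 (proof)] -/
private theorem natDegree_det_mul_powMatrix_le' {K : Type u} [Field K] {n k : ℕ}
    (B : Matrix (Fin k) (Fin n) K) :
    ((B.map (Polynomial.C : K →+* K[X])) *
        Matrix.of (fun (x : Fin n) (j : Fin k) =>
          (Polynomial.X : K[X]) ^ (((x : ℕ) + 1) * ((j : ℕ) + 1)))).det.natDegree ≤ n * k ^ 2 := by
  classical
  set M := (B.map (Polynomial.C : K →+* K[X])) *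
        Matrix.of (fun (x : Fin n) (j : Fin k) =>
          (Polynomial.X : K[X]) ^ (((x : ℕ) + 1) * ((j : ℕ) + 1))) with hM
  have hentry : ∀ a j, (M a j).natDegree ≤ n * k := by
    intro a j
    rw [hM, Matrix.mul_apply]
    refine natDegree_sum_le_of_forall_le _ _ fun x _ => ?_
    rw [Matrix.map_apply, Matrix.of_apply]
    refine (natDegree_C_mul_X_pow_le _ _).trans ?_
    exact Nat.mul_le_mul (Nat.succ_le_of_lt x.isLt) (Nat.succ_le_of_lt j.isLt)
  rw [Matrix.det_apply']
  refine natDegree_sum_le_of_forall_le _ _ fun σ _ => ?_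
  refine natDegree_mul_le.trans ?_
  rw [natDegree_intCast, zero_add]
  refine (natDegree_prod_le _ _).trans ?_
  calc ∑ i, (M (σ i) i).natDegree ≤ ∑ _i : Fin k, n * k :=
        Finset.sum_le_sum fun i _ => hentry _ _
    _ = n * k ^ 2 := by simp; ring

open Polynomial in
/-- **The good `α` of Claim 3.3 can be a NATURAL NUMBER `≤ Δ^m K²`** ("there exists some positive
integer `α < D^{2n}`"): for linearly independent polynomials `P_0, …, P_{K−1}` with support in the
box of side `Δ`, over a field of characteristic `0`, some `a ∈ ℕ`, `a ≤ Δ^m K²`, makes the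
Kronecker evaluation matrix `(P_j(kronPoint Δ (a^{i+1})))` nonsingular — the rank-extractor
polynomial `det(M · (u^{(ℓ+1)(i+1)}))` is nonzero (ASSS16 Lemma 7.1, `det_mul_powMatrix_ne_zero`) of
degree `≤ Δ^m K²`, so it cannot vanish at the `Δ^m K² + 1` naturals `0, …, Δ^m K²`.
[cite: ChatterjeeTengse2023, Lemma 3.2 / Claim 3.3 (v1: Lemma 39 / Claim 40; p0014.txt:L78–L92); AgrawalEtAl2011, Lemma 7.1, Cor. 7.2] -/
theorem exists_nat_kronecker_det_eval_ne_zero {F : Type u} [Field F] [CharZero F] {m K : ℕ}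
    (Δ : ℕ) {P : Fin K → MvPolynomial (Fin m) F}
    (hPind : LinearIndependent F P) (hP : ∀ j, ∀ d ∈ (P j).support, ∀ b, d b < Δ) :
    ∃ a : ℕ, a ≤ Δ ^ m * K ^ 2 ∧ (Matrix.of fun (i : Fin K) (j : Fin K) =>
      eval (kronPoint Δ ((a : F) ^ ((i : ℕ) + 1))) (P j)).det ≠ 0 := by
  classical
  set V : Matrix (Fin (Δ ^ m)) (Fin K) F[X] :=
    Matrix.of (fun (x : Fin (Δ ^ m)) (j : Fin K) =>
      (Polynomial.X : F[X]) ^ (((x : ℕ) + 1) * ((j : ℕ) + 1))) with hV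
  set Q : F[X] := ((coeffMatrix Δ P).map (Polynomial.C : F →+* F[X]) * V).det with hQ
  have hQ0 : Q ≠ 0 :=
    ASSS16.det_mul_powMatrix_ne_zero (coeffMatrix Δ P) (linearIndependent_coeffMatrix Δ hPind hP)
  have hdeg : Q.natDegree ≤ Δ ^ m * K ^ 2 := natDegree_det_mul_powMatrix_le' _
  -- some natural number `≤ deg Q` is not a root
  have hex : ∃ a : Fin (Δ ^ m * K ^ 2 + 1), Q.eval ((a : ℕ) : F) ≠ 0 := by
    by_contra hall
    push Not at hall
    have hinj : Function.Injective (fun a : Fin (Δ ^ m * K ^ 2 + 1) => ((a : ℕ) : F)) := by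
      intro a b hab
      have h' : ((a : ℕ) : F) = ((b : ℕ) : F) := hab
      exact Fin.ext (by exact_mod_cast h')
    exact hQ0 (Polynomial.eq_zero_of_natDegree_lt_card_of_eval_eq_zero Q hinj hall
      (by rw [Fintype.card_fin]; omega))
  obtain ⟨a, ha⟩ := hex
  refine ⟨a, by have := a.isLt; omega, fun h0 => ha ?_⟩
  -- the evaluated extractor product is the transposed evaluation matrix with scaled columns
  set α : F := ((a : ℕ) : F) with hα
  set E : Matrix (Fin K) (Fin K) F :=
    Matrix.of fun (i : Fin K) (j : Fin K) => eval (kronPoint Δ (α ^ ((i : ℕ) + 1))) (P j) with hE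
  have hprod : coeffMatrix Δ P * Matrix.of (fun (ℓ : Fin (Δ ^ m)) (i : Fin K) =>
      α ^ (((ℓ : ℕ) + 1) * ((i : ℕ) + 1))) =
      E.transpose * Matrix.diagonal fun i : Fin K => α ^ ((i : ℕ) + 1) := by
    ext j i
    rw [coeffMatrix_mul_powMatrix_apply Δ hP, Matrix.mul_diagonal, Matrix.transpose_apply, hE,
      Matrix.of_apply, mul_comm]
  have heval : Q.eval α = (coeffMatrix Δ P * Matrix.of (fun (ℓ : Fin (Δ ^ m)) (i : Fin K) =>
      α ^ (((ℓ : ℕ) + 1) * ((i : ℕ) + 1)))).det := by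
    rw [hQ, ← Polynomial.coe_evalRingHom, RingHom.map_det, RingHom.mapMatrix_apply]
    congr 1
    refine Matrix.ext fun j i => ?_
    simp [Matrix.mul_apply, hV, Polynomial.eval_finsetSum]
  rw [heval, hprod, Matrix.det_mul, Matrix.det_transpose, h0, zero_mul]

/-- **Cheap numerals**: `τ(a) ≤ 3 (log₂ a + 1)` — Horner on the binary digits, `a = 2·⌊a/2⌋ + (a mod 2)`
with `2 = 1 + 1` ("`α` can be computed by a constant-free circuit of size `O(log α)`").
[cite: ChatterjeeTengse2023, proof of Lemma 3.5 (v1: Lemma 42; p0015.txt:L70–L73); Burgisser2000, §1.4] -/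
theorem constantFreeComplexity_C_natCast_le_log {σ : Type v} (a : ℕ) :
    constantFreeComplexity (C (a : ℤ) : MvPolynomial σ ℤ) ≤ 3 * (Nat.log 2 a + 1) := by
  induction a using Nat.strong_induction_on with
  | _ a ih =>
    rcases Nat.lt_or_ge a 2 with ha | ha
    · interval_cases a
      · simp
      · rw [Nat.cast_one, C_1, constantFreeComplexity_one]; exact Nat.zero_le _
    · have hlog : Nat.log 2 a = Nat.log 2 (a / 2) + 1 := by
        rw [Nat.log_div_base]
        have : 1 ≤ Nat.log 2 a := Nat.le_log_of_pow_le (by norm_num) (by simpa using ha)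
        omega
      have hih := ih (a / 2) (Nat.div_lt_self (by omega) (by norm_num))
      have hdecomp : (C (a : ℤ) : MvPolynomial σ ℤ) =
          C ((a / 2 : ℕ) : ℤ) * (1 + 1) + C ((a % 2 : ℕ) : ℤ) := by
        rw [← C_1, ← C_add, ← C_mul, ← C_add]
        congr 1
        have : (a : ℤ) = 2 * (a / 2 : ℕ) + (a % 2 : ℕ) := by exact_mod_cast (Nat.div_add_mod a 2).symm
        rw [this]; ring
      have hbit : constantFreeComplexity (C ((a % 2 : ℕ) : ℤ) : MvPolynomial σ ℤ) = 0 := by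
        rcases Nat.mod_two_eq_zero_or_one a with h | h
        · rw [h, Nat.cast_zero, C_0, constantFreeComplexity_zero]
        · rw [h, Nat.cast_one, C_1, constantFreeComplexity_one]
      have htwo : constantFreeComplexity ((1 : MvPolynomial σ ℤ) + 1) ≤ 1 := by
        calc constantFreeComplexity ((1 : MvPolynomial σ ℤ) + 1)
            ≤ constantFreeComplexity (1 : MvPolynomial σ ℤ) +
                constantFreeComplexity (1 : MvPolynomial σ ℤ) + 1 := constantFreeComplexity_add_le _ _
          _ = 1 := by rw [constantFreeComplexity_one]
      rw [hdecomp, hlog]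
      calc constantFreeComplexity (C ((a / 2 : ℕ) : ℤ) * (1 + 1) + C ((a % 2 : ℕ) : ℤ) : MvPolynomial σ ℤ)
          ≤ constantFreeComplexity (C ((a / 2 : ℕ) : ℤ) * (1 + 1) : MvPolynomial σ ℤ) +
              constantFreeComplexity (C ((a % 2 : ℕ) : ℤ) : MvPolynomial σ ℤ) + 1 :=
            constantFreeComplexity_add_le _ _
        _ ≤ (constantFreeComplexity (C ((a / 2 : ℕ) : ℤ) : MvPolynomial σ ℤ) +
              constantFreeComplexity ((1 : MvPolynomial σ ℤ) + 1) + 1) + 0 + 1 := by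
            rw [hbit]
            gcongr
            exact constantFreeComplexity_mul_le _ _
        _ ≤ (3 * (Nat.log 2 (a / 2) + 1) + 1 + 1) + 0 + 1 := by gcongr
        _ = 3 * (Nat.log 2 (a / 2) + 1 + 1) := by ring

end NatExtractor

end Literature.Barriers.ValiantsHypothesis

end
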